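import Summits.SmoothPoincare4.SmoothPoincare4.Theorems.ConvexBisectionAcyclicBisectionExistsSteinRealisationTopologicalEnds
import Summits.SmoothPoincare4.SmoothPoincare4.Theorems.ConvexBisectionAcyclicBisectionExistsPageInvariance
import Summits.SmoothPoincare4.SmoothPoincare4.Theorems.ConvexBisectionAcyclicBisectionExistsPageTwistingTransverseLoop
import Literature.Topology.FourManifolds.HandleAttachingMapsTransport
import Literature.Topology.FourManifolds.LefschetzHandlebody
import HarnessLib

/-!
# Transport of the prefix sub-link of a Lefschetz link along a page rotation
(wave 1 of lead c5, brick NF6-T1b-2 of stub `stub_steinRealisation` = NF6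
`Literature.Geometry.Symplectic.steinRealisation_of_sorted_modelsOnFibred`, line `modp-braid-orbits`
r11, crux `ConvexBisection.AcyclicBisectionExists`, item stmt-SmoothPoincare4-10508; registered
sub-goal `helper_isLefschetzLink_prefix_transport`, corollary
`helper_isLefschetzHandlebody_of_split_of_rotation`)

NF6 realises a sorted fibred model of word `P ++ N` as `M = W₁ ∪ W₂` with `W₁ = X₁` the base with
the `|P|` prefix handles attached (`helper_isMultiAttachment_split_append`).  Its last clause
`IsLefschetzHandlebody g P W₁` asks for a Lefschetz link of the SHORT word `P`: attaching circles in
the pages of the standard directions `pageDir |P| i`.  Restriction of a link realising `P ++ N` to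
its first `|P|` handles (`IsLefschetzLink.prefix`, `…SteinRealisationTopologicalEnds.lean`) gives
pairwise disjoint ranges, the right shadows `(P.get i).1` and the right page twistings
`if (P.get i).2 then -1 else 1`, but leaves the `i`-th circle in the page of direction
`pageDir (|P| + |N|) i` of the LONG word.  A page-rotation ambient isotopy `R` of `Base g`
(built separately, brick NF6-T1b-1; here `R` and its two properties are HYPOTHESES) moving, at
every time, every page into a page (clause "fibred") and, at time `1`, the page of direction
`pageDir (|P| + |N|) i` onto the page of direction `pageDir |P| i` for `i < |P|` (clause
"schedule") repairs this: transporting the prefix attaching maps along the end diffeomorphism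
`R.toDiffeomorph 1` (`HandleAttachingMap.transport`: attaching circle `R 1 ∘ K`, handle framing
`d(R 1)(ν)`) keeps

* pairwise disjointness of the ranges (`HandleAttachingMap.pairwise_disjoint_range_transport`);
* the shadows (`shadow_comp_ambientIsotopy`: every stage of an ambient isotopy is homotopic to the
  identity, and the shadow is a homotopy invariant);
* the page twistings (`pageTwisting_transport_eq_of_fibred`: the twisting loop of the moved framed
  circle never vanishes as long as the circle stays inside pages, which the fibred clause grants,
  so the winding number is constant along the isotopy);

and puts the `i`-th circle into the standard page `page g (pageDir |P| i)` (schedule clause):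
`helper_isLefschetzLink_prefix_transport`.  Since a manifold which is the base with handles
attached along the prefix maps is also the base with handles attached along the transported maps
(`HandleAttachingMap.IsMultiAttachment.transport`, Kosinski VI §6 / VIII (1.2)), the piece `X₁` IS a
Lefschetz handlebody of the word `P` as soon as such an `R` exists:
`helper_isLefschetzHandlebody_of_split_of_rotation`.

Everything is proved; no named facts, no `sorry`.  References: J. B. Etnyre, T. Fuller,
*Realizing 4-manifolds as achiral Lefschetz fibrations*, IMRN 2006, §2 [EtnyreFuller2006];
R. İ. Baykur, *Kähler decomposition of 4-manifolds*, AGT 6 (2006), proof of Thm. 5.1 [Baykur2006];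
A. A. Kosinski, *Differential Manifolds* (1993), VI §6 [Kosinski1993].
-/

noncomputable section

-- the prescribed namespace `Summit.<P>.<Sub>.…` duplicates `SmoothPoincare4` (P = Sub)
set_option linter.dupNamespace false

open scoped Manifold ContDiff Topology
open Set Function Metric
open Literature.Topology.FourManifolds Literature.Topology.FourManifolds.LefschetzBase

namespace Summit.SmoothPoincare4.SmoothPoincare4.Theorems.AcyclicBisectionExists.ModpBraidOrbits

variable {g : ℕ}

/-! ## §1 One attaching map transported along a stage of an ambient isotopy -/

/-- **The attaching circle of `h̄.transport (R s)` is `R s ∘ K`** (definitional unfolding of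
`HandleAttachingMap.attachingCircle_transport` and `AmbientIsotopy.coe_toDiffeomorph`).
[folklore] -/
theorem attachingCircle_transport_toDiffeomorph (R : AmbientIsotopy (𝓡∂ 4) (Base g)) (s : ℝ)
    (h : HandleAttachingMap 3 2 (Base g)) :
    (h.transport (R.toDiffeomorph s)).attachingCircle = R.toFun s ∘ h.attachingCircle := rfl

/-- **Transport along a stage of an ambient isotopy of the base does not change the shadow of the
attaching circle** (`shadow_comp_ambientIsotopy`: `R s` is homotopic to the identity through the
stages `R (r s)`, `r ∈ [0, 1]`, and the shadow is a free-homotopy invariant).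
[cite: EtnyreFuller2006, §2] -/
theorem shadow_attachingCircle_transport_toDiffeomorph (R : AmbientIsotopy (𝓡∂ 4) (Base g))
    (s : ℝ) (h : HandleAttachingMap 3 2 (Base g)) :
    shadow g (h.transport (R.toDiffeomorph s)).attachingCircle
        (h.transport (R.toDiffeomorph s)).continuous_attachingCircle =
      shadow g h.attachingCircle h.continuous_attachingCircle := by
  -- generalise the (proof-carrying) loop argument before rewriting it
  have key : ∀ (K : sphere (0 : EuclideanSpace ℝ (Fin 2)) 1 → Base g) (hK : Continuous K),
      K = R.toFun s ∘ h.attachingCircle →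
        shadow g K hK = shadow g h.attachingCircle h.continuous_attachingCircle := by
    rintro K hK rfl
    exact shadow_comp_ambientIsotopy R s h.continuous_attachingCircle hK
  exact key _ _ (attachingCircle_transport_toDiffeomorph R s h)

/-- **Transport along a FIBRED ambient isotopy of the base does not change the page twisting of the
handle framing.**  "Fibred" is the simultaneous form delivered by the page-rotation schedule: at
every time `t` every page `page g c` (`‖c‖ = 1`) is carried into ONE page `page g c'`
(`‖c'‖ = 1`).  Choosing, for the page containing the attaching circle of `h̄`, such a direction
`c' = c t` at every time gives the hypothesis of `pageTwisting_transport_eq_of_fibred` (the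
twisting loop of the moved framed circle never vanishes inside pages, so its winding number is
constant in `t`). [cite: EtnyreFuller2006, §2] -/
theorem pageTwisting_transport_toDiffeomorph_of_pagewise (R : AmbientIsotopy (𝓡∂ 4) (Base g))
    (hfib : ∀ (t : ℝ) (c : ℂ), ‖c‖ = 1 → ∃ c' : ℂ, ‖c'‖ = 1 ∧
      ∀ x : Base g, x ∈ page g c → R.toFun t x ∈ page g c')
    (h : HandleAttachingMap 3 2 (Base g)) {c : ℂ} (hc : ‖c‖ = 1)
    (hK : ∀ θ, h.attachingCircle θ ∈ page g c) :
    pageTwisting g (h.transport (R.toDiffeomorph 1)).attachingCircle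
        (h.transport (R.toDiffeomorph 1)).attachingFraming =
      pageTwisting g h.attachingCircle h.attachingFraming := by
  choose c' hc' hpage using fun t => hfib t c hc
  exact pageTwisting_transport_eq_of_fibred R h c' (fun s _ => hc' s)
    fun s _ θ => hpage s _ (hK θ)

/-! ## §2 The prefix sub-link transported along a page rotation -/

/-- **The prefix sub-link of a Lefschetz link of `P ++ N`, transported along the end of a
page-rotation isotopy, is a Lefschetz link of `P`** (dot-free working form of
`helper_isLefschetzLink_prefix_transport`, hypotheses in the order of use).  Hypotheses on the
ambient isotopy `R` of `Base g`: (fibred) at every time every page goes into a page; (schedule) at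
time `1` the page of direction `pageDir (|P| + |N|) i` goes into the page of direction
`pageDir |P| i` for `i < |P|`.  Conclusion: the family
`i ↦ (h̄ (castAdd i)).transport (R 1)`, `i : Fin |P|`, satisfies the four clauses of
`IsLefschetzLink g P`: disjoint ranges (`pairwise_disjoint_range_transport` on
`IsLefschetzLink.prefix`), circles in the standard pages (schedule), shadows `(P.get i).1`
(`shadow_comp_ambientIsotopy`), page twistings `∓1` (`pageTwisting_transport_eq_of_fibred`).
[cite: Baykur2006, Thm. 5.1 (proof, pp. 13–14)] -/
theorem IsLefschetzLink.prefix_transport {P N : List ((Fin g ⊕ Fin g → ℤ) × Bool)}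
    {h : Fin (P ++ N).length → HandleAttachingMap 3 2 (Base g)} (hl : IsLefschetzLink g (P ++ N) h)
    (R : AmbientIsotopy (𝓡∂ 4) (Base g))
    (hfib : ∀ (t : ℝ) (c : ℂ), ‖c‖ = 1 → ∃ c' : ℂ, ‖c'‖ = 1 ∧
      ∀ x : Base g, x ∈ page g c → R.toFun t x ∈ page g c')
    (hsched : ∀ i : ℕ, i < P.length → ∀ x : Base g,
      x ∈ page g (pageDir (P.length + N.length) i) → R.toFun 1 x ∈ page g (pageDir P.length i)) :
    IsLefschetzLink g P (fun i : Fin P.length =>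
      (h (Fin.cast List.length_append.symm (Fin.castAdd N.length i))).transport
        (R.toDiffeomorph 1)) := by
  obtain ⟨hdisj, hpage, hshadow, htwist⟩ := IsLefschetzLink.prefix hl
  refine ⟨HandleAttachingMap.pairwise_disjoint_range_transport hdisj _, fun i θ => ?_,
    fun i => ?_, fun i => ?_⟩
  · -- the schedule clause puts the `i`-th circle into the standard page
    have e : pageDir (P ++ N).length (i : ℕ) = pageDir (P.length + N.length) i := by
      rw [List.length_append]
    have hmem := hpage i θ
    rw [e] at hmem
    exact hsched i i.2 _ hmem
  · -- shadows are invariant under the stages of an ambient isotopy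
    rw [shadow_attachingCircle_transport_toDiffeomorph R 1]
    exact hshadow i
  · -- page twistings are invariant along a fibred isotopy
    rw [pageTwisting_transport_toDiffeomorph_of_pagewise R hfib _ (norm_pageDir _ _) (hpage i)]
    exact htwist i

/-- **Registered sub-goal `helper_isLefschetzLink_prefix_transport` of stub `stub_steinRealisation`
(NF6, brick T1b-2, lead c5 wave 1): transport of the prefix link along a page rotation.**  For a
Lefschetz link `h̄` of the sorted word `P ++ N` over `Base g` and an ambient isotopy `R` of
`Base g` which is fibred (at every time every page `page g c`, `‖c‖ = 1`, is carried into one page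
`page g c'`, `‖c'‖ = 1`) and re-spaces the prefix pages at time `1` (the page of direction
`pageDir (|P| + |N|) i` is carried into the page of direction `pageDir |P| i`, `i < |P|`), the
first `|P|` attaching maps transported along the end diffeomorphism `R.toDiffeomorph 1` form a
Lefschetz link of the short word `P`: disjoint ranges, circles in the standard pages
`page g (pageDir |P| i)`, shadows `(P.get i).1`, page twistings `-1`/`+1` according to the sign
of the letter. [cite: Baykur2006, Thm. 5.1 (proof, pp. 13–14)] -/
theorem helper_isLefschetzLink_prefix_transport :
    ∀ (g : ℕ) (P N : List ((Fin g ⊕ Fin g → ℤ) × Bool))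
      (h : Fin (P ++ N).length → Literature.Topology.FourManifolds.HandleAttachingMap 3 2
        (Literature.Topology.FourManifolds.LefschetzBase.Base g))
      (R : Literature.Topology.FourManifolds.AmbientIsotopy (𝓡∂ 4)
        (Literature.Topology.FourManifolds.LefschetzBase.Base g)),
      Literature.Topology.FourManifolds.LefschetzBase.IsLefschetzLink g (P ++ N) h →
      (∀ (t : ℝ) (c : ℂ), ‖c‖ = 1 → ∃ c' : ℂ, ‖c'‖ = 1 ∧
        ∀ x : Literature.Topology.FourManifolds.LefschetzBase.Base g,
          x ∈ Literature.Topology.FourManifolds.LefschetzBase.page g c →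
            R.toFun t x ∈ Literature.Topology.FourManifolds.LefschetzBase.page g c') →
      (∀ i : ℕ, i < P.length → ∀ x : Literature.Topology.FourManifolds.LefschetzBase.Base g,
        x ∈ Literature.Topology.FourManifolds.LefschetzBase.page g
            (Literature.Topology.FourManifolds.LefschetzBase.pageDir (P.length + N.length) i) →
          R.toFun 1 x ∈ Literature.Topology.FourManifolds.LefschetzBase.page g
            (Literature.Topology.FourManifolds.LefschetzBase.pageDir P.length i)) →
      Literature.Topology.FourManifolds.LefschetzBase.IsLefschetzLink g P
        (fun i : Fin P.length =>
          (h (Fin.cast List.length_append.symm (Fin.castAdd N.length i))).transport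
            (R.toDiffeomorph 1)) :=
  fun _ _ _ _ R hl hfib hsched => IsLefschetzLink.prefix_transport hl R hfib hsched

/-! ## §3 The prefix piece of a split multi-attachment is a Lefschetz handlebody of `P` -/

/-- **Registered corollary `helper_isLefschetzHandlebody_of_split_of_rotation` (NF6, brick T1b-2,
lead c5 wave 1): the prefix piece is `X(F; P)`.**  Let `h̄` be a Lefschetz link of the sorted word
`P ++ N` over `Base g` and let `X₁` be the base with the first `|P|` handles attached
simultaneously (`HandleAttachingMap.IsMultiAttachment` of the prefix family, as delivered by
`helper_isMultiAttachment_split_append`).  If there is an ambient isotopy `R` of `Base g` which is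
fibred and re-spaces the prefix pages at time `1` (the two clauses of
`helper_isLefschetzLink_prefix_transport`; existence is the page-rotation schedule, brick T1b-1),
then `X₁` is a Lefschetz handlebody of the short word `P`: the transported prefix family is a
Lefschetz link of `P` (`helper_isLefschetzLink_prefix_transport`) and `X₁` is also the base with
handles attached along it (`HandleAttachingMap.IsMultiAttachment.transport`: precompose the
embedding of the unsurgered part with `(R 1)⁻¹`, keep the handles — Kosinski VI §6 / VIII (1.2)).
[cite: Baykur2006, Thm. 5.1 (proof, pp. 13–14)] -/
theorem helper_isLefschetzHandlebody_of_split_of_rotation :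
    ∀ (g : ℕ) (P N : List ((Fin g ⊕ Fin g → ℤ) × Bool))
      (h : Fin (P ++ N).length → Literature.Topology.FourManifolds.HandleAttachingMap 3 2
        (Literature.Topology.FourManifolds.LefschetzBase.Base g))
      (X₁ : Type) [TopologicalSpace X₁] [ChartedSpace (EuclideanHalfSpace 4) X₁],
      Literature.Topology.FourManifolds.LefschetzBase.IsLefschetzLink g (P ++ N) h →
      Literature.Topology.FourManifolds.HandleAttachingMap.IsMultiAttachment
        (fun i : Fin P.length => h (Fin.cast List.length_append.symm (Fin.castAdd N.length i)))
        (𝓡∂ 4) X₁ →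
      (∃ R : Literature.Topology.FourManifolds.AmbientIsotopy (𝓡∂ 4)
          (Literature.Topology.FourManifolds.LefschetzBase.Base g),
        (∀ (t : ℝ) (c : ℂ), ‖c‖ = 1 → ∃ c' : ℂ, ‖c'‖ = 1 ∧
          ∀ x : Literature.Topology.FourManifolds.LefschetzBase.Base g,
            x ∈ Literature.Topology.FourManifolds.LefschetzBase.page g c →
              R.toFun t x ∈ Literature.Topology.FourManifolds.LefschetzBase.page g c') ∧
        (∀ i : ℕ, i < P.length → ∀ x : Literature.Topology.FourManifolds.LefschetzBase.Base g,
          x ∈ Literature.Topology.FourManifolds.LefschetzBase.page g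
              (Literature.Topology.FourManifolds.LefschetzBase.pageDir (P.length + N.length) i) →
            R.toFun 1 x ∈ Literature.Topology.FourManifolds.LefschetzBase.page g
              (Literature.Topology.FourManifolds.LefschetzBase.pageDir P.length i))) →
      Literature.Topology.FourManifolds.LefschetzBase.IsLefschetzHandlebody g P X₁ := by
  intro g P N h X₁ _ _ hl hX₁ hR
  obtain ⟨R, hfib, hsched⟩ := hR
  exact ⟨fun i : Fin P.length =>
      (h (Fin.cast List.length_append.symm (Fin.castAdd N.length i))).transport (R.toDiffeomorph 1),
    IsLefschetzLink.prefix_transport hl R hfib hsched, hX₁.transport (R.toDiffeomorph 1)⟩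

end Summit.SmoothPoincare4.SmoothPoincare4.Theorems.AcyclicBisectionExists.ModpBraidOrbits

end
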